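import Summits.BirchSwinnertonDyer.BirchSwinnertonDyer.Theorems.SignedLowerHalvesSmallImageLowerHalfBothSignsRttD2TwistLevel
import Literature.NumberTheory.ComplexMultiplication.EllipticUnits.ImaginaryQuadraticMainConjectureCarriersOCores
import Literature.NumberTheory.GaloisRepresentations.RelativeCorestrictionNaturalityRestricted
import HarnessLib

/-!
# Route `SignedLowerHalves`, crux L `SmallImageLowerHalfBothSigns` (stmt-BirchSwinnertonDyer-23599), line `rtt_w3` v14 — E2, row «D-tw-coh» part 2a:
# the level twist commutes with the CORESTRICTIONS of the tower

INPUTS hand `bsd-inputs-honda-p1` g23 (LEAD g11 RULING «U» (U5); sequel of `…RttD2TwistLevel`, part 1a: `levelTwistO`). For characters `θ, θ'` congruent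
mod `p^k` on `N_P` and on the BIG level subgroup `U = Gal(K̄/F)` (hence on every `U' = Gal(K̄/F') ≤ U`):
* ★★ `relCoresO_levelTwistO` — **`cor_{F'/F} ∘ tw_{F'} = tw_F ∘ cor_{F'/F}`** on `H^i(G_P(F'), 𝒪 ⊗ μ_{p^k} ⊗ θ) → H^i(G_P(F), 𝒪 ⊗ μ_{p^k} ⊗ θ')`, ALL degrees:
  the relative corestriction only sees the `U_P`-module structure, for which the twist (identity on vectors) IS a morphism — the tree's
  `relCor_cohomologyMap_of` (`Literature/…/RelativeCorestrictionNaturalityRestricted.lean`, filed with this row) read on the one ambient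
  `G_P`-module per `k` exactly as `…CarriersOCores.relCoresO_map_levelMapHomO`.
With part 1b (`levelTwistO_levelRedO`, `levelTwistO_levelScalarO`, `levelTwistEquivO`) this makes the level twists an isomorphism of the inverse
systems `(H^i(G_P(K_n), 𝒪 ⊗ μ_{p^k} ⊗ ·))_{n ≥ n(k), k}` (cores in `n`, reductions in `k`) on the cofinal range where `θ' ≡ θ (mod p^k)` on `Gal(K̄/K_n)`.
NOT here (rest of part 2, L): the conj-SEMILINEARITY `tw ∘ conj^θ_γ = η(γ)⁻¹ · conj^{θ'}_γ ∘ tw` and the cofinal assembly on the pinned data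
`D(χ₀).Dᵢ.H ≃+ D(θ*).Dᵢ.H` carrying pins/`nsub`.
ONE THEOREM; no `def`, no named fact, no `sorry`; crux L, crux M, E2 and BSD remain OPEN and are proved for NO curve by any of this.
References: [NeukirchSchmidtWingberg2008] I §5 Prop. 1.5.2; [SerreGaloisCohomology1997] I §2.5; [Rubin2000] Ch. VI §6.1–6.2; [JohnsonLeungKings2011] Def. 4.2 (94).
-/

set_option autoImplicit false
-- the Theorems namespace of this sub repeats the summit name by design (D-0017 nested layout)
set_option linter.dupNamespace false

noncomputable section

open scoped NumberField TensorProduct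
open CategoryTheory Field IsDedekindDomain
open Literature.NumberTheory.GaloisRepresentations
open Literature.NumberTheory.GaloisRepresentations.DiscreteGaloisModule
open Literature.NumberTheory.EllipticCurves
open Literature.NumberTheory.ComplexMultiplication.EllipticUnits
open Literature.NumberTheory.ComplexMultiplication.EllipticUnits.JohnsonLeungKings2011

namespace Summit.BirchSwinnertonDyer.BirchSwinnertonDyer.Theorems.SmallImageRttD2Twist

variable {K : Type} [Field K] [NumberField K] {p : ℕ} [Fact p.Prime] (S : Set (PadicAlgCl p))
  (P : Set (HeightOneSpectrum (𝓞 K))) (θ θ' : absoluteGaloisGroup K →ₜ* (padicCoeffIntegers S)ˣ) (k : ℕ)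
  (hN : ∀ σ ∈ ramificationSubgroup K P, ∃ b : padicCoeffIntegers S,
    ((θ' σ : (padicCoeffIntegers S)ˣ) : padicCoeffIntegers S) = (θ σ : (padicCoeffIntegers S)ˣ) + ((p : padicCoeffIntegers S)) ^ k * b)

/-- ★★ **The level twist commutes with the corestrictions of the tower**: for open `U' ≤ U ≤ Γ_K` with `θ' ≡ θ (mod p^k)` on `U` (and on `N_P`),
`cor_{F'/F} (tw_{F'} y) = tw_F (cor_{F'/F} y)` on `H^i(G_P(F'), 𝒪 ⊗ μ_{p^k} ⊗ θ) → H^i(G_P(F), 𝒪 ⊗ μ_{p^k} ⊗ θ')`, every degree `i` — the relative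
corestriction is natural in `U_P`-equivariant coefficient maps (`relCor_cohomologyMap_of`), and the twist is one (identity on vectors).
[cite: NeukirchSchmidtWingberg2008, I §5 Prop. 1.5.2] [cite: SerreGaloisCohomology1997, I §2.5] [cite: Rubin2000, Ch. VI §6.1–6.2] -/
theorem relCoresO_levelTwistO {U U' : Subgroup (absoluteGaloisGroup K)} (h : U' ≤ U)
    (hU : IsOpen (U : Set (absoluteGaloisGroup K))) (hU' : IsOpen (U' : Set (absoluteGaloisGroup K)))
    (hUc : ∀ σ ∈ U, ∃ b : padicCoeffIntegers S,
      ((θ' σ : (padicCoeffIntegers S)ˣ) : padicCoeffIntegers S) = (θ σ : (padicCoeffIntegers S)ˣ) + ((p : padicCoeffIntegers S)) ^ k * b)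
    (i : ℕ) (y : levelCohO S P θ U' k i) :
    relCoresO S P θ' h hU hU' k i (levelTwistO S P θ θ' k hN U' (fun σ hσ ↦ hUc σ (h hσ)) i y) =
      levelTwistO S P θ θ' k hN U hUc i (relCoresO S P θ h hU hU' k i y) := by
  haveI : TotallyDisconnectedSpace (GaloisGroupUnramifiedOutside K P) :=
    Literature.GroupTheory.ProfiniteSubquotients.totallyDisconnectedSpace_quotient
      (ramificationSubgroup K P) (ramificationSubgroup_isClosed K P)
  haveI : IsClosed (imGS P U : Set (GaloisGroupUnramifiedOutside K P)) := isClosed_imGS' _ hU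
  haveI : IsClosed (imGS P U' : Set (GaloisGroupUnramifiedOutside K P)) := isClosed_imGS' _ hU'
  haveI : ((imGS P U').subgroupOf (imGS P U)).FiniteIndex := by
    haveI := finiteIndex_imGS' P hU'
    infer_instance
  letI : Fintype (↥(imGS P U) ⧸ (imGS P U').subgroupOf (imGS P U)) := Fintype.ofFinite _
  exact relCor_cohomologyMap_of (imGS P U) (imGS P U') (coeffGSO S P θ k) (coeffGSO S P θ' k) (Subgroup.map_mono h) i
    (twistLevelHomO S P θ θ' k hN U' (fun σ hσ ↦ hUc σ (h hσ))) (twistLevelHomO S P θ θ' k hN U hUc) (fun _ ↦ rfl) y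

end Summit.BirchSwinnertonDyer.BirchSwinnertonDyer.Theorems.SmallImageRttD2Twist

end
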